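import Summits.ABC.IUTFork.Repair.RHReqsideTableV1

/-!
# D-0122 AXIS B — REQB-TABLE v1 (b8ac679ede5d795b) transcribed: the VERDICT, CONSISTENCY, cone and T-word COLUMNS AGREE WITH THE PRE-REGISTERED WORD
# RULES row by row, and the tallies (sequel of `RHReqsideTableV1`; same `table`, `decide` throughout)

abc-iut cell, rung LADDER-ABC:A2.RESCUE.H; row WP0 (director-abc g4 2026-08-27T07:16:54Z) of seat abc-iut-reqb-typ-2; owner abc-iut-rh-lead g3/g4; RQ7 audit
abc-iut-reqb-ref-1. Everything is evaluated over `RH.ReqsideTableV1.table` = the 110 rows of `plan/rescue/R-H/ROUND3/REQB-TABLE.tsv` v1 (sha16 b8ac679ede5d795b =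
referee sheet `REQB-SIGNED-ref-1-v1.tsv` a23349b525227fe7; A ≡ B `CERT-AB-ALL-v411.tsv` 41a7fc45c940dd1b; SIGN 110/110) as transcribed there (column ↦ field map
and scalings in that file's module docstring). WHAT THE THEOREMS SAY: the transcribed class-word columns are NOT free text — each is the pre-registered rule
(REQB-SPEC v0.2 §4/§6(a) = abc-iut-reqb-ref-1 PREREG P1–P6, R8) applied to the numeric columns of the same row, and `decide` confirms that on all 110 rows;
plus the tallies quoted in the D-0121 FINAL Part (II).
* `full_iff_rhoMin`: «this bed full» (`n_rho = n`) ⟺ printed `ρ_min ≥ 1.0000` on all 110 rows; MEETS ⟹ this bed full, `ρ_pooled ≥ 1`, lower-median `ρ ≥ 1`;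
  9 HEX79 rows are full while their point is PARTIAL through the FREY133 row (the referee's «9 HEX79 rows read MEETS-on-this-bed»).
* `hxMax_max`: the table's maximum crossing height `154 316.1` nats is attained, on a MEETS row (the signed sheet's «h× max 154,316 nats»).
* `verdict_agrees`: PRIOR ⟺ MEETS ∧ k5-only; KEPT-WITH-NEW-THEORY-TAG (either variant) ⟺ MEETS ∧ ¬consistent, the R8-eligible variant ⟺ moreover
  `R8_partner_raises_mu_min = yes`, the other ⟺ `= no`; none ⟺ ¬MEETS. `verdict_tally`: 4 / 24 / 6 / 76 rows = 2 / 12 / 3 / 38 points.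
* `consistency_tally`: INCONSISTENT 74 · NEW-THEORY 28 · DEFINABLE 6 · PRINT-SETTING 2 rows; 8 consistent rows, 4 of them MEETS (the PRIOR rows) and 4 PARTIAL.
* `print_row`: the all-print knob vector occurs exactly on the PRINT-SETTING rows = the regression point P00: PARTIAL (8/133, 35/79), `j₀` median 8, `T_mod/T =
  1.0000`, NO CHANGE, on both beds.
* `cone_agrees`: `cone = baseline` ⟺ k3 at print; tally 60 / 46 / 4, the 4 NOT COMPUTED rows being `κ = 5/2` × `c ∈ {0, 1/2}`, none MEETS.
* `meets_rows_lower_target`: every MEETS row has `μ₀ ≤ 3/4`; none of the 54 rows at print's target `μ₀ = 1` MEETS; 34 of the 56 rows with `μ₀ < 1` do.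
* `meets_rows_tword`: on MEETS rows the T-word is VANISHES (17) or REDUCES-STRONGLY (17). `tword_tally`: 51 / 30 / 22 / 5 / 2.
* `tword_bands`: the T-word lies in the pre-registered band of `max(T_mod/T pooled, lower-median)` on every row (VANISHES ⟹ both 0.0000; REDUCES-STRONGLY ⟹
  `≤ 0.5`; REDUCES ⟹ `(0.5, 0.9]`; NO CHANGE ⟹ `[0.99, 1.01]`; INCREASES ⟹ `> 1.01`).
HONEST FRAMING. A transcription certificate of a computed, referee-signed table of OUR typed functional's sensitivities; knob settings are parameter changes
in our cell currency, never claims that [IUTchI–III] admit them; the CONSISTENCY words are abc-iut-reqb-rf-1 / abc-iut-reqb-rf-2's located class words (located ≠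
adjudicated). Nothing here asserts that abc is proved or refuted, or that [IUTchIII] Cor. 3.12 / [IUTchIV] Thm. 1.10 holds or fails; no side on any author;
computed ≠ proved; typed ≠ proved; signed ≠ endorsed; transcribed ≠ computed. [claim: Mochizuki2012, status: disputed] for every IUT locution.
[folklore arithmetic at the table's numerals]
-/

namespace Summit.ABC.IUTFork.Repair.RH.ReqsideTableV1

/-! ## §1 Counts vs the printed ratios -/

/-- **«This bed full» ⟺ printed `ρ_min ≥ 1.0000`** on all 110 rows (`nRho = n` iff `rhoMin4 ≥ 10000`); MEETS ⟹ this bed full, `ρ_pooled ≥ 1`, lower-median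
`ρ ≥ 1`; and exactly 9 rows are full on their bed while the point is PARTIAL, all on HEX79 (abc-iut-reqb-ref-1's «9 HEX79 rows read MEETS-on-this-bed where the
point word is PARTIAL»). [folklore arithmetic at the table's numerals] -/
theorem full_iff_rhoMin :
    (∀ r ∈ table, r.full = decide (10000 ≤ r.rhoMin4)) ∧
      (∀ r ∈ table, r.meets = true → r.full = true ∧ 10000 ≤ r.rhoPooled4 ∧ 10000 ≤ r.rhoLowmed4) ∧
      (table.filter fun r => r.full && !r.meets).length = 9 ∧ (table.filter fun r => r.full && !r.meets && r.bed == .HEX79).length = 9 := by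
  decide

/-- **The maximum crossing height `154 316.1` nats (`hxMax10 = 1 543 161`) is attained on a MEETS row**; with `hxMax_lt` this is the signed sheet's «h× max
154,316 nats ≪ 4.7·10⁶». [folklore arithmetic at the table's numerals] -/
theorem hxMax_max : ∃ r ∈ table, r.hxMax10 = 1543161 ∧ r.meets = true := by
  decide

/-! ## §2 VERDICT column = the word rule, row by row; tallies -/

/-- **`verdict_agrees` — the transcribed VERDICT class is the word rule applied to the other columns, on every row**: PRIOR ⟺ MEETS ∧ k5-only (R8);
KEPT-WITH-NEW-THEORY-TAG (either variant) ⟺ MEETS ∧ ¬consistent; its R8-eligible variant ⟺ moreover `R8_partner_raises_mu_min = yes`, the other variant ⟺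
`= no`; none ⟺ ¬MEETS. [folklore arithmetic at the table's numerals] -/
theorem verdict_agrees :
    ∀ r ∈ table, (r.verdict = .PRIOR ↔ r.meets = true ∧ r.k5Only = true) ∧
      ((r.verdict = .KEPT_R8 ∨ r.verdict = .KEPT_notR8) ↔ r.meets = true ∧ r.consistent = false) ∧
      (r.verdict = .KEPT_R8 ↔ r.meets = true ∧ r.consistent = false ∧ r.r8 = .yes) ∧
      (r.verdict = .KEPT_notR8 ↔ r.meets = true ∧ r.consistent = false ∧ r.r8 = .no) ∧
      (r.verdict = .none ↔ r.meets = false) := by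
  decide

/-- **VERDICT tally**: PRIOR 4 rows · KEPT (R8-eligible) 24 · KEPT (not R8-eligible) 6 · none 76 — i.e. 2 / 12 / 3 / 38 points (FREY133 rows).
[folklore arithmetic at the table's numerals] -/
theorem verdict_tally :
    (table.filter fun r => r.verdict == .PRIOR).length = 4 ∧ (table.filter fun r => r.verdict == .KEPT_R8).length = 24 ∧
      (table.filter fun r => r.verdict == .KEPT_notR8).length = 6 ∧ (table.filter fun r => r.verdict == .none).length = 76 ∧
      (table.filter fun r => r.verdict == .PRIOR && r.bed == .FREY133).length = 2 ∧
      (table.filter fun r => r.verdict == .KEPT_R8 && r.bed == .FREY133).length = 12 ∧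
      (table.filter fun r => r.verdict == .KEPT_notR8 && r.bed == .FREY133).length = 3 ∧
      (table.filter fun r => r.verdict == .none && r.bed == .FREY133).length = 38 := by
  decide

/-! ## §3 CONSISTENCY column: tallies; the print row -/

/-- **CONSISTENCY tally**: INCONSISTENT 74 rows · NEW-THEORY 28 · DEFINABLE 6 · PRINT-SETTING 2 (37 / 14 / 3 / 1 points); the consistent rows are 8, of which
4 MEETS (the PRIOR rows) and 4 PARTIAL (S-k5-3/4 and P00, both beds). [folklore arithmetic at the table's numerals] -/
theorem consistency_tally :
    (table.filter fun r => r.cons == .INCONSISTENT).length = 74 ∧ (table.filter fun r => r.cons == .NEW_THEORY).length = 28 ∧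
      (table.filter fun r => r.cons == .DEFINABLE).length = 6 ∧ (table.filter fun r => r.cons == .PRINT_SETTING).length = 2 ∧
      (table.filter fun r => r.cons == .INCONSISTENT && r.bed == .FREY133).length = 37 ∧
      (table.filter fun r => r.cons == .NEW_THEORY && r.bed == .FREY133).length = 14 ∧
      (table.filter fun r => r.consistent).length = 8 ∧ (table.filter fun r => r.consistent && r.meets).length = 4 ∧
      (table.filter fun r => r.consistent && !r.meets).length = 4 := by
  decide

/-- **The all-print vector is exactly the PRINT-SETTING rows = the regression point P00**: PARTIAL (8/133, 35/79), `j₀` median 8 on both beds, `T_mod/T = 1.0000`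
pooled and median, T-word NO CHANGE. [folklore arithmetic at the table's numerals] -/
theorem print_row :
    (∀ r ∈ table, (r.allPrint = true ↔ r.cons = .PRINT_SETTING) ∧
      (r.allPrint = true → r.cntFrey = 8 ∧ r.cntHex = 35 ∧ r.j0med = 8 ∧ r.tPooled4 = 10000 ∧ r.tMed4 = 10000 ∧ r.tword = .noChange)) ∧
      (table.filter fun r => r.allPrint).length = 2 ∧ (table.filter fun r => r.allPrint && r.bed == .FREY133).length = 1 := by
  decide

/-! ## §4 cone column ⟺ k3 -/

/-- **cone column ⟺ k3**: `cone = baseline` exactly on the rows with k3 at print; tally baseline 60 · inherited 46 · NOT COMPUTED 4, the latter being the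
`κ = 5/2` × `c ∈ {0, 1/2}` rows, none of which MEETS. (The «inherited n/n» entries are the engines' per-datum numbers; the kernel sign theorem
`RH.ReqsideShellProfile.multiplierCell_le_print` is place-conditional, `R_out ≤ 0`.) [folklore arithmetic at the table's numerals] -/
theorem cone_agrees :
    (∀ r ∈ table, (r.cone = .baseline ↔ r.k3Print = true) ∧ (r.cone = .notComputed → r.k1 = .kappa 5 ∧ r.c2 ≤ 1 ∧ r.meets = false)) ∧
      (table.filter fun r => r.cone == .baseline).length = 60 ∧ (table.filter fun r => r.cone == .inherited).length = 46 ∧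
      (table.filter fun r => r.cone == .notComputed).length = 4 := by
  decide

/-! ## §5 Target knob k5 on the MEETS rows; T-words -/

/-- **Every MEETS row lowers the target: `μ₀ ≤ 3/4`** (`mu0x64 ≤ 48`); none of the 54 rows at print's target `μ₀ = 1` MEETS, while 34 of the 56 rows with
`μ₀ < 1` do. [folklore arithmetic at the table's numerals] -/
theorem meets_rows_lower_target :
    (∀ r ∈ table, r.meets = true → r.mu0x64 ≤ 48) ∧ (table.filter fun r => r.mu0x64 == 64).length = 54 ∧
      (table.filter fun r => r.mu0x64 == 64 && r.meets).length = 0 ∧ (table.filter fun r => r.mu0x64 != 64).length = 56 ∧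
      (table.filter fun r => r.mu0x64 != 64 && r.meets).length = 34 := by
  decide

/-- **T-word on MEETS rows**: VANISHES on 17, REDUCES-STRONGLY on 17 (no other word). [folklore arithmetic at the table's numerals] -/
theorem meets_rows_tword :
    (∀ r ∈ table, r.meets = true → r.tword = .vanishes ∨ r.tword = .reducesStrongly) ∧
      (table.filter fun r => r.meets && r.tword == .vanishes).length = 17 ∧
      (table.filter fun r => r.meets && r.tword == .reducesStrongly).length = 17 := by
  decide

/-- **T-word tally**: REDUCES-STRONGLY 51 · INCREASES 30 · VANISHES 22 · NO CHANGE 5 · REDUCES 2. [folklore arithmetic at the table's numerals] -/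
theorem tword_tally :
    (table.filter fun r => r.tword == .reducesStrongly).length = 51 ∧ (table.filter fun r => r.tword == .increases).length = 30 ∧
      (table.filter fun r => r.tword == .vanishes).length = 22 ∧ (table.filter fun r => r.tword == .noChange).length = 5 ∧
      (table.filter fun r => r.tword == .reduces).length = 2 := by
  decide

/-- **`tword_bands` — the T-word column lies in the pre-registered band of `max(T_mod/T pooled, T_mod/T lower-median)` on every row** (REQB-SPEC §4 / PREREG, the
less favourable statistic deciding; units of 10⁻⁴): VANISHES ⟹ both `= 0`; REDUCES-STRONGLY ⟹ `max ≤ 5000`; REDUCES ⟹ `5000 < max ≤ 9000`; NO CHANGE ⟹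
`9900 ≤ max ≤ 10100`; INCREASES ⟹ `10100 < max`. (Printed decimals cannot separate VANISHES from a REDUCES-STRONGLY rounding to 0.0000; the engines' exact
`T_mod = 0` decides that word.) [folklore arithmetic at the table's numerals] -/
theorem tword_bands :
    ∀ r ∈ table,
      (r.tword = .vanishes → r.tPooled4 = 0 ∧ r.tMed4 = 0) ∧ (r.tword = .reducesStrongly → max r.tPooled4 r.tMed4 ≤ 5000) ∧
        (r.tword = .reduces → 5000 < max r.tPooled4 r.tMed4 ∧ max r.tPooled4 r.tMed4 ≤ 9000) ∧
        (r.tword = .noChange → 9900 ≤ max r.tPooled4 r.tMed4 ∧ max r.tPooled4 r.tMed4 ≤ 10100) ∧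
        (r.tword = .increases → 10100 < max r.tPooled4 r.tMed4) := by
  decide

end Summit.ABC.IUTFork.Repair.RH.ReqsideTableV1
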